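import Summits.HodgeConjecture.HodgeConjecture.Theorems.Ring2AbelianAllTensorWeilCarriers
import Summits.HodgeConjecture.HodgeConjecture.Theorems.WeilTypeLadderTensorLocalAnchor
import Summits.HodgeConjecture.HodgeConjecture.Theses.VHCAbelianSchemesRoad
import HarnessLib

/-!
# Ring 2 / AbelianAll (André column) × the Weil ladder — the ROWS of the tensor-anchor junction on the cell's named decls (leaf file)

research route, not a corollary; conditional on HC_CM plus one named minimal statement.

LEAF FILE (imports route files; nothing should import it). The junction `hasLocallyAlgebraicTensorAnchors_of_door_of_tensorWeilCarriers`
(PART AC-c, `Ring2AbelianAllTensorWeilCarriers`, route-independent) composed with the Weil ladder's kernel theorem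
`WeilTypeLadder.weilClass_algebraic_of_deligne_of_tensorLocalAnchors` (Deligne's PEL family THROUGH the target: W-engine, rationality along the
section, the local clause at the tensor point, Baire / countable union, Lefschetz on `X`):

* §1 **`weilClass_algebraic_of_deligne_of_door_of_tensorWeilCarriers`** — for `p` prime, `p ≡ 3 (4)`, `p ≥ 7`, `k ≥ 1`:
  `deligne1982_weilFamily_hodgeWeilSection ∧ LocalVariationalHodgeFor 𝒪 ∧ TensorWeilCarriers 𝒪 k p ⟹` every rational `(k,k)` Weil class of EVERY
  complex abelian `2k`-fold `(X, Φ)`, `Φ ≫ Φ = -p`, is algebraic (all discriminants).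
* §2 **`weilSixfoldsSqrtMinus7_of_deligne_of_twistedPerfectDoor_of_tensorWeilTwistedCarriers : K-C → TwistedPerfectDoor →
  deligne1982_weilFamily_hodgeWeilSection → TensorWeilTwistedCarriers 3 7 → HeckePrymWeil.WeilSixfoldsSqrtMinus7`** (crux stmt-HodgeConjecture-1260:
  ALL `ℚ(√-7)` sixfolds, split and non-split) and the tenfold twin `… → TensorWeilTwistedCarriers 5 11 → WeilTenfoldsSqrtMinus11` (stmt-1262):
  the `(6, 3)` / `(10, 5)` content of the road's diagonal LOCALISED to the tensor points `Y ~ A₁ × A₁` and to the Weil plane there — Bloch's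
  find-the-sheaf problem for the KNOWN cycles `Re/Im (R + i√p·S)ᵏ` (`R`, `S` rational divisor classes; `weilClassesOf_splitSquare_eq_span`),
  with TWISTED `AdmTw`-admissible carriers; the road's binders BY NAME, Deligne's family BY NAME (the ladder's fact), ONE carrier node.
* §3 `weilSixfoldsSqrtMinus7_of_deligne_of_twistedPerfectDoor_of_abelianTwistedDesigns` — AB-c's designs node reaches the crux (lattice of AC-c §2).

HONEST: the carrier nodes are OPEN, not in print, not implied by HC; `deligne1982_weilFamily_hodgeWeilSection` is a NAMED FACT (Deligne, LNM 900,
proof of Thm. 4.8; theorem in print); the door is the road's binder `TwistedPerfectDoor` (route-file labels apply; for the `bfSingleAdmissible`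
disjunct print supports `B₀ = 0` — BF Thm. 5.1 — or initial-segment degree sets; RING2-MAP §AbelianAll AA2.487). Nothing here says any carrier,
door, crux, `HC_CM`, `HC_AV` or HC holds; `HC_CM` does not occur. References: [cite: Deligne1982HodgeCycles, §4 proof of Thm. 4.8 (a)–(c)]
[cite: BuchweitzFlenner2003, §5 Thm. 5.1] [cite: Markman2025SecantWeil, §7.3 and Thm. 1.4.1] [cite: Pridham2024Semiregularity, Cor. 2.25 and Rem. 2.26–2.27]
[cite: Bloch1972Semiregularity, Remark (7.5)] [cite: vanGeemen1994HodgeAV, 5.3–5.7].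
-/

noncomputable section

open CategoryTheory CategoryTheory.Limits AlgebraicGeometry Topology

namespace Summit.HodgeConjecture.HodgeConjecture.Ring2.AbelianAll

-- the cell's namespace repeats the summit name (`Summit.HodgeConjecture.HodgeConjecture…`), as in every `Ring2*` file
set_option linter.dupNamespace false

open Literature.AlgebraicGeometry Literature.AlgebraicGeometry.Motives
open Literature.AlgebraicGeometry.HodgeTheory
open Literature.AlgebraicTopology.SingularHomology
open Summit.Ventures.HSemireg (ObjClass LocalVariationalHodgeFor)
open Summit.HodgeConjecture.HodgeConjecture.Theses
open Summit.HodgeConjecture.HodgeConjecture.WeilTypeLadder (weilClass_algebraic_of_deligne_of_tensorLocalAnchors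
  weilSixfoldsSqrtMinus7_of_deligne_of_tensorLocalAnchors weilTenfoldsSqrtMinus11_of_deligne_of_tensorLocalAnchors)

variable {𝒪 : ObjClass} {k p : ℕ}

/-! ## §1 With Deligne's family through the target: every Weil class for `K = ℚ(√-p)` -/

/-- **EVERY WEIL CLASS FOR `K = ℚ(√-p)` FROM DELIGNE'S FAMILY, THE DOOR AND CARRIERS FOR WEIL CLASSES AT TENSOR POINTS** (`p` prime,
`p ≡ 3 (4)`, `p ≥ 7`, `k ≥ 1`; all discriminants): the junction (`Ring2AbelianAllTensorWeilCarriers` §1) composed with the ladder's kernel theorem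
`WeilTypeLadder.weilClass_algebraic_of_deligne_of_tensorLocalAnchors` (W-engine, rationality along the section, the local clause at the tensor
point, Baire / countable union, Lefschetz on `X`). [cite: Deligne1982HodgeCycles, §4 proof of Thm. 4.8 (a)–(c)] [cite: BuchweitzFlenner2003, §5 Thm. 5.1]
[cite: vanGeemen1994HodgeAV, 5.3–5.7] [cite: Bloch1972Semiregularity, Remark (7.5)] -/
theorem weilClass_algebraic_of_deligne_of_door_of_tensorWeilCarriers (p k : ℕ) (hp : p.Prime) (hp4 : p % 4 = 3) (hp7 : 7 ≤ p) (hk : 1 ≤ k)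
    (hD : deligne1982_weilFamily_hodgeWeilSection) (hT : LocalVariationalHodgeFor 𝒪) (hcar : TensorWeilCarriers 𝒪 k p)
    (X : AbelianVariety ℂ) (Φ : X ⟶ X) (hX : X.dim = 2 * k) (hΦ : Φ ≫ Φ = -((p : ℤ) • 𝟙 X)) (c : complexBetti X.X (2 * k))
    (hcW : c ∈ weilClassesOf X Φ k p) (hcr : IsRationalClass c) (hcH : IsOfHodgeType (2 * k) X.X (2 * k) k k c) :
    c ∈ algebraicClasses X.X k :=
  weilClass_algebraic_of_deligne_of_tensorLocalAnchors p k hp hp4 hp7 hk hD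
    (hasLocallyAlgebraicTensorAnchors_of_door_of_tensorWeilCarriers hT hcar) X Φ hX hΦ c hcW hcr hcH

/-! ## §2 On the cell's named decls: the Weil cruxes at `√-7` (sixfolds) and `√-11` (tenfolds) -/

/-- **`WeilSixfoldsSqrtMinus7 ⟸ K-C ∧ TwistedPerfectDoor ∧ deligne1982_weilFamily_hodgeWeilSection ∧ TensorWeilTwistedCarriers 3 7`** (crux
stmt-HodgeConjecture-1260: the Weil classes of ALL complex abelian sixfolds `(A, φ)` with `φ² = -7`, split and non-split): the `(6, 3)` content of
the road's diagonal, LOCALISED to the `ℚ(√-7)`-tensor sixfolds `Y ~ A₁ × A₁` (`dim A₁ = 3`) and to the Weil plane there — semiregular TWISTED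
representatives (`AdmTw`), modulo the `θ`-ray, of the known cycles `Re/Im (R + i√7·S)³`. The road's binders BY NAME; Deligne's family BY NAME
(the ladder's fact); ONE carrier node. [cite: Deligne1982HodgeCycles, §4 proof of Thm. 4.8] [cite: Markman2025SecantWeil, §7.3 and Thm. 1.4.1]
[cite: Pridham2024Semiregularity, Cor. 2.25 and Rem. 2.26–2.27] [cite: Bloch1972Semiregularity, Remark (7.5)] -/
theorem weilSixfoldsSqrtMinus7_of_deligne_of_twistedPerfectDoor_of_tensorWeilTwistedCarriers (hC : VHCAbelianSchemesRoad.ChernCharacterOnBetti)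
    (hDoor : VHCAbelianSchemesRoad.TwistedPerfectDoor) (hD : deligne1982_weilFamily_hodgeWeilSection) (hcar : TensorWeilTwistedCarriers 3 7) :
    HeckePrymWeil.WeilSixfoldsSqrtMinus7 := by
  obtain ⟨C⟩ := (hC : Nonempty ChernCharacterBetti)
  exact weilSixfoldsSqrtMinus7_of_deligne_of_tensorLocalAnchors hD
    (hasLocallyAlgebraicTensorAnchors_of_twistedPerfectDoorVHC_of_tensorWeilCarriers (hDoor C) (hcar C))

/-- **`WeilTenfoldsSqrtMinus11 ⟸ K-C ∧ TwistedPerfectDoor ∧ deligne1982_weilFamily_hodgeWeilSection ∧ TensorWeilTwistedCarriers 5 11`** (crux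
stmt-HodgeConjecture-1262): the `(10, 5)` cell of the road's diagonal localised to the `ℚ(√-11)`-tensor tenfolds and their Weil planes.
[cite: Deligne1982HodgeCycles, §4 proof of Thm. 4.8] [cite: Markman2025SecantWeil, §7.3] [cite: Pridham2024Semiregularity, Cor. 2.25 and Rem. 2.26–2.27]
[cite: Bloch1972Semiregularity, Remark (7.5)] -/
theorem weilTenfoldsSqrtMinus11_of_deligne_of_twistedPerfectDoor_of_tensorWeilTwistedCarriers (hC : VHCAbelianSchemesRoad.ChernCharacterOnBetti)
    (hDoor : VHCAbelianSchemesRoad.TwistedPerfectDoor) (hD : deligne1982_weilFamily_hodgeWeilSection) (hcar : TensorWeilTwistedCarriers 5 11) :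
    HeckePrymWeil.WeilTenfoldsSqrtMinus11 := by
  obtain ⟨C⟩ := (hC : Nonempty ChernCharacterBetti)
  exact weilTenfoldsSqrtMinus11_of_deligne_of_tensorLocalAnchors hD
    (hasLocallyAlgebraicTensorAnchors_of_twistedPerfectDoorVHC_of_tensorWeilCarriers (hDoor C) (hcar C))

/-! ## §3 The designs node reaches the crux -/

/-- **AB-c's designs node reaches the `√-7` sixfold crux through tensor points** (granted Deligne's family): K-C ∧ door ∧ Deligne ∧
`AbelianTwistedDesigns` ⟹ `WeilSixfoldsSqrtMinus7`, factoring through §2 and the lattice of the junction file. [cite: Deligne1982HodgeCycles, §4 proof of Thm. 4.8]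
[cite: Bloch1972Semiregularity, Remark (7.5)] -/
theorem weilSixfoldsSqrtMinus7_of_deligne_of_twistedPerfectDoor_of_abelianTwistedDesigns (hC : VHCAbelianSchemesRoad.ChernCharacterOnBetti)
    (hDoor : VHCAbelianSchemesRoad.TwistedPerfectDoor) (hD : deligne1982_weilFamily_hodgeWeilSection) (hdes : AbelianTwistedDesigns) :
    HeckePrymWeil.WeilSixfoldsSqrtMinus7 :=
  weilSixfoldsSqrtMinus7_of_deligne_of_twistedPerfectDoor_of_tensorWeilTwistedCarriers hC hDoor hD
    (tensorWeilTwistedCarriers_of_abelianTwistedDesigns (by norm_num) (by norm_num) hdes)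

end Summit.HodgeConjecture.HodgeConjecture.Ring2.AbelianAll

end
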